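import Summits.BirchSwinnertonDyer.Rank1Residual.Supersingular.SignedLambdaParity
import Literature.NumberTheory.EllipticCurves.Sprung2017.SharpFlatPAdicLFunctionTwoProofs
import Mathlib.NumberTheory.LegendreSymbol.ZModChar
import HarnessLib

/-!
# PARITY(2), part 1 (Θ-level): `(−1)^{λ(θ_n(f))} = χ₈(N) = (2/N)` at `p = 2` — the
# characteristic-2 "second coefficient" mechanism (cell `b2b-bsdres`, O1 sub-cell `p = 2`;
# lens-1 GEN 8 packet, ported by cc-typer-4 GEN 5 as typer item (23′); part 2 =
# `SignedLambdaParityTwo.lean`: the `μ`-free Θ-level law and the transfer to Sprung's pair)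

HONEST FRAMING (run/shared/lean/b2b/bsd-rank1-residual/, verbatim in every file): the goal of the
cell is to DELETE the COMBINATION-SHAPED residual classes of the Birch–Swinnerton-Dyer formula for
ALL analytic-rank `≤ 1` elliptic curves over `ℚ` — "full BSD formula for every rank `≤ 1` curve in
class `C`" assembled STRICTLY from published theorems — so that the rank-`≤ 1` remainder becomes
exactly the CONSTRUCTION-SHAPED classes, which are TYPED (missing-input `Prop`s), NOT attempted.
This is not "finishing BSD". THEOREMS ONLY (no definition, no named fact; every hypothesis explicit —
`IsNewformOf`, good reduction at `2`, `2 ∣ a₂`, a Sprung pair, `L ≠ 0`, `μ(L) = 0`; nothing about any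
particular curve is asserted; nothing booked; labels unchanged).

CREDIT. This file is the o1 lens-1 GEN 8 packet `HOME/b2b-bsdres-o1-idea-1-g8/lean/G8_MTParityTwo.lean`
(planner-b2b-bsdres-o1-idea-1-g8-0, 2026-08-21T14:01Z; sha16 of the source `fd24c5857114f6b5`;
lead-verified rc 0, o1 lead GEN 19 C147 / R-G19.8), ported verbatim up to the namespace
(`LensOneG8` → this file's namespace) and this docstring, per the one-writer rule (typer item (23′),
queue v3.7c; split in two files by the 400-line rule: THIS file = §1–§3). It is the `p = 2` companion of `SignedLambdaParity.lean` (odd `p`: `(−1)^{λ(L♯)} = σ`).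

## What this file proves

MECHANISM.  The odd-`p` theorem `neg_one_pow_lam_mazurTate` reads the Mazur–Tate functional equation
`θ_n(T) ≡ σ (1+T)^c θ_n((1+T)^{-1} − 1) (mod ω_n)` modulo `(p, T^{pⁿ})` at the coefficient of `T^λ`,
`λ = ord_T θ̄_n`; at `p = 2` that comparison is empty (`−1 = 1`).  The coefficient of `T^{λ+1}` is
not: since `(1+T)^{2ⁿ−1} − 1 = T + binom(2ⁿ−1, 2) T² + ⋯` with `binom(2ⁿ−1, 2)` odd (`n ≥ 2`), it gives
**`c + λ ≡ 0 (mod 2)`** (`even_add_natTrailingDegree_of_dvd_charTwo`, pure algebra over any field of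
characteristic `2`), where `c = (−s_N) mod 2ⁿ` is the Fricke exponent, `η_N · 5^{s_N} = N` in
`ℤ/2^{n+2}` (`cyclotomicGenerator 2 = 5`, `cyclotomicExponent 2 = 2`, `torsionOrder 2 = 2`), and
`5^s ≡ 1, 5 (mod 8)` for `s` even, odd gives `(−1)^{s_N} = χ₈(N)` (`neg_one_pow_val_eq_chi8`).  Hence
`(−1)^{λ(Θ)} = χ₈(N)` for any `Θ ∈ ℤ₂⟦T⟧` lifting `θ_n` with `μ(Θ) = 0`, `λ(Θ) + 2 ≤ 2ⁿ`
(`neg_one_pow_lam_mazurTate_two`; the sign `σ` is used only through `σ̄ = 1` in `𝔽₂`), and even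
without `μ(Θ) = 0` (`neg_one_pow_lam_mazurTate_two'`, §3b: divide out `2^μ` against the monic `ω_n`).
Transfer to the Sprung pair: `θ_n = ω_n Q_n − (u_n L♯ + v_n L♭)` integrally
(`exists_integral_mazurTate_of_isSprungPair_two`, from `exists_integral_isSprungPair_two` +
`IsSprungPair.unique`, hypothesis `2 ∣ a₂` only), the tree's p-uniform mod-`p` layer readings
`lam_eq_lam_add_of_mu_eq_zero_of_odd/even` (`λ(θ_n) = λ(L♯) + deg ω_n⁺` on odd layers,
`= λ(L♭) + deg ω_n⁻` on even layers), and AT `p = 2`: `deg ω_n⁺ = 2 + 8 + 32 + ⋯` is EVEN,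
`deg ω_n⁻ = 1 + 4 + 16 + ⋯` is ODD (`even_natDegree_cyclotomicOmegaPlus_two`,
`odd_natDegree_cyclotomicOmegaMinus_two`).  RESULTS: `neg_one_pow_lam_sharp_two`, `neg_one_pow_lam_flat_two`,
`odd_lam_sharp_add_lam_flat_two`, `even_lam_sharp_two_iff` (`Even λ♯ ↔ N ≡ ±1 (8)`),
`even_lam_flat_two_iff` (`Even λ♭ ↔ N ≡ ±3 (8)`) — the o1 census law PARITY(2) (2 922/2 922, lens-1
GEN 6; EVIDENCE, not used) as a theorem for all three supersingular traces, with NO `Log`–`ι`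
transformation law and no completed pair.  (For `a₂ = 0` the full functional equations of `L♯, L♭`
themselves — Sprung 2017 Cor. 4.14 at `p = 2` — are in
`Literature/Barriers/BirchSwinnertonDyer/PAdicFunctionalEquationSharpFlatTwoProofs`.)
Inputs from the tree, all valid at ANY prime: `cyclotomicOmega_dvd_mazurTateElement_sub`,
`exists_classMap_eq_natCast`, `X_pow_dvd_reduction_sub_of_mazurTate`, `red_eq_coe_map_trunc_of_mazurTate`,
`mu_eq_zero_and_lam_eq_of_red_ne_zero`, `exists_odd_layer` / `exists_even_layer`,
`exists_sign_isFrickeEigen`, `not_dvd_level_of_isNewformOf`, and at `p = 2` Sprung's pair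
`exists_integral_isSprungPair_two` (typer item (22), p274088).
-/

set_option autoImplicit false

noncomputable section

open scoped Classical MatrixGroups ModularForm

open Polynomial

/-! ## §1. The characteristic-2 mechanism (pure algebra) -/

namespace Summit.BirchSwinnertonDyer.Rank1Residual.Supersingular

variable {k : Type*} [Field k] [CharP k 2]

omit [CharP k 2] in
/-- `[X¹](pq) = p₀q₁ + p₁q₀`. -/
private theorem coeff_one_mul' (p q : k[X]) :
    (p * q).coeff 1 = p.coeff 0 * q.coeff 1 + p.coeff 1 * q.coeff 0 := by
  rw [coeff_mul, Finset.Nat.sum_antidiagonal_eq_sum_range_succ_mk]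
  simp [Finset.sum_range_succ]

/-- An odd natural number is `1` in characteristic `2`. -/
private theorem natCast_eq_one_of_odd' {n : ℕ} (hn : Odd n) : (n : k) = 1 := by
  obtain ⟨i, rfl⟩ := hn
  push_cast
  rw [CharTwo.two_eq_zero, zero_mul, zero_add]

omit [CharP k 2] in
/-- `[X¹]p = p'(0)`. -/
private theorem coeff_one_eq_eval_derivative (p : k[X]) : p.coeff 1 = (derivative p).eval 0 := by
  rw [← coeff_zero_eq_eval_zero, coeff_derivative]
  simp

/-- **Second-coefficient mechanism (characteristic 2).** `k` a field with `2 = 0`, `θ ≠ 0`,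
`λ := natTrailingDegree θ`, `4 ∣ m`, `λ + 2 ≤ m`, and
`X^m ∣ θ − (X+1)^c · θ.comp ((X+1)^{m−1} − 1)`. Then `c + λ` is even.
(Coefficient of `X^{λ+1}`: `[X^{λ+1}]RHS = θ₁ + (c + λ·binom(m−1,2)) θ₀`, `binom(m−1,2)` odd.) -/
theorem even_add_natTrailingDegree_of_dvd_charTwo {θ : k[X]} (hθ : θ ≠ 0) {m : ℕ} (hm : 4 ∣ m)
    (hlt : θ.natTrailingDegree + 2 ≤ m) {c : ℕ}
    (hdvd : X ^ m ∣ θ - (X + 1) ^ c * θ.comp ((X + 1) ^ (m - 1) - 1)) :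
    Even (c + θ.natTrailingDegree) := by
  obtain ⟨j, hj⟩ := hm
  set l := θ.natTrailingDegree with hl
  set P : k[X] := (X + 1) ^ (m - 1) - 1 with hP
  have hm1 : ((m - 1 : ℕ) : k) = 1 := natCast_eq_one_of_odd' ⟨2 * j - 1, by omega⟩
  have hm2 : (((m - 1).choose 2 : ℕ) : k) = 1 := by
    obtain ⟨i, rfl⟩ : ∃ i, j = i + 1 := ⟨j - 1, by omega⟩
    have h : m - 1 = 4 * i + 3 := by omega
    have hc : (4 * i + 3).choose 2 = (4 * i + 3) * (2 * i + 1) := by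
      rw [Nat.choose_two_right, show 4 * i + 3 - 1 = 4 * i + 2 by omega,
        show (4 * i + 3) * (4 * i + 2) = (4 * i + 3) * (2 * i + 1) * 2 by ring,
        Nat.mul_div_cancel _ two_pos]
    rw [h, hc]
    exact natCast_eq_one_of_odd' (Nat.odd_mul.mpr ⟨⟨2 * i + 1, by ring⟩, ⟨i, rfl⟩⟩)
  have hP0 : P.coeff 0 = 0 := by simp [hP, coeff_X_add_one_pow]
  have hP1 : P.coeff 1 = 1 := by simp [hP, coeff_X_add_one_pow, hm1, coeff_one]
  have hP2 : P.coeff 2 = 1 := by simp [hP, coeff_X_add_one_pow, hm2, coeff_one]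
  obtain ⟨P₁, hP₁⟩ : X ∣ P := X_dvd_iff.mpr hP0
  have hP₁0 : P₁.coeff 0 = 1 := by rw [← hP1, hP₁, coeff_X_mul]
  have hP₁1 : P₁.coeff 1 = 1 := by rw [← hP2, hP₁, coeff_X_mul]
  obtain ⟨θ₀, hθ₀⟩ : X ^ l ∣ θ :=
    X_pow_dvd_iff.mpr fun d hd => coeff_eq_zero_of_lt_natTrailingDegree hd
  have ha : θ₀.coeff 0 ≠ 0 := by
    have h1 : θ.coeff (0 + l) = θ₀.coeff 0 := by rw [hθ₀, coeff_X_pow_mul]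
    rw [zero_add] at h1
    rw [← h1]
    exact mem_support_iff.mp (natTrailingDegree_mem_support_of_nonzero hθ)
  have hPl : P ^ l = X ^ l * P₁ ^ l := by rw [← mul_pow, ← hP₁]
  set D₀ : k[X] := θ₀ - (X + 1) ^ c * P₁ ^ l * θ₀.comp P with hD₀
  have hD : θ - (X + 1) ^ c * θ.comp P = X ^ l * D₀ := by
    rw [hD₀, hθ₀, mul_comp, X_pow_comp, hPl]; ring
  have hX2 : X ^ 2 ∣ D₀ := by
    have h1 : X ^ (l + 2) ∣ X ^ l * D₀ := hD ▸ (pow_dvd_pow X hlt).trans hdvd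
    rw [pow_add] at h1
    exact (mul_dvd_mul_iff_left (pow_ne_zero l X_ne_zero)).mp h1
  have hcoeff : D₀.coeff 1 = 0 := X_pow_dvd_iff.mp hX2 1 (by norm_num)
  have hf0 : ((X + 1 : k[X]) ^ c).coeff 0 = 1 := by simp [coeff_X_add_one_pow]
  have hf1 : ((X + 1 : k[X]) ^ c).coeff 1 = (c : k) := by simp [coeff_X_add_one_pow]
  have hg0 : (P₁ ^ l).coeff 0 = 1 := by
    rw [coeff_zero_eq_eval_zero, eval_pow, ← coeff_zero_eq_eval_zero, hP₁0, one_pow]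
  have hg1 : (P₁ ^ l).coeff 1 = (l : k) := by
    rw [coeff_one_eq_eval_derivative, derivative_pow, eval_mul, eval_mul, eval_C, eval_pow,
      ← coeff_zero_eq_eval_zero, hP₁0, one_pow, mul_one, ← coeff_one_eq_eval_derivative, hP₁1,
      mul_one]
  have hh0 : (θ₀.comp P).coeff 0 = θ₀.coeff 0 := by
    rw [coeff_zero_eq_eval_zero, eval_comp, ← coeff_zero_eq_eval_zero P, hP0,
      ← coeff_zero_eq_eval_zero]
  have hh1 : (θ₀.comp P).coeff 1 = θ₀.coeff 1 := by
    rw [coeff_one_eq_eval_derivative, derivative_comp, eval_mul, eval_comp,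
      ← coeff_zero_eq_eval_zero P, hP0, ← coeff_one_eq_eval_derivative, hP1, one_mul,
      ← coeff_one_eq_eval_derivative]
  have key : ((l : k) + c) * θ₀.coeff 0 = 0 := by
    have e : D₀.coeff 1 = θ₀.coeff 1 - (((X + 1 : k[X]) ^ c * P₁ ^ l).coeff 0 * (θ₀.comp P).coeff 1 +
        ((X + 1 : k[X]) ^ c * P₁ ^ l).coeff 1 * (θ₀.comp P).coeff 0) := by
      rw [hD₀, coeff_sub, coeff_one_mul']
    rw [mul_coeff_zero, coeff_one_mul', hf0, hf1, hg0, hg1, hh0, hh1, hcoeff] at e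
    linear_combination e
  have hlc : ((l + c : ℕ) : k) = 0 := by
    push_cast
    exact (mul_eq_zero.mp key).resolve_right ha
  have h2 : 2 ∣ l + c := (CharP.cast_eq_zero_iff k 2 (l + c)).mp hlc
  rw [add_comm]
  exact even_iff_two_dvd.mpr h2

end Summit.BirchSwinnertonDyer.Rank1Residual.Supersingular

/-! ## §2. The Fricke exponent at `2` and `χ₈` -/

namespace Summit.BirchSwinnertonDyer.Rank1Residual.Supersingular

open CongruenceSubgroup WeierstrassCurve Literature.NumberTheory.EllipticCurves
  Literature.NumberTheory.EllipticCurves.ModularForms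
  Literature.NumberTheory.EllipticCurves.Sprung2017
  Summit.BirchSwinnertonDyer.Rank1Residual.X1.MuLambda

/-- `𝔽₂ = ℤ₂/2ℤ₂` has characteristic `2` (transport along `PadicInt.residueField : 𝔽₂ ≃+* ℤ/2`). -/
theorem charP_residueField_two : CharP (IsLocalRing.ResidueField ℤ_[2]) 2 :=
  charP_of_injective_ringHom (f := (PadicInt.residueField (p := 2)).symm.toRingHom)
    (PadicInt.residueField (p := 2)).symm.injective 2

/-- `5^s mod 8` is `1` for `s` even and `5` for `s` odd. -/
theorem five_pow_mod_eight (s : ℕ) : 5 ^ s % 8 = if Even s then 1 else 5 := by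
  rcases Nat.even_or_odd s with ⟨t, ht⟩ | ⟨t, ht⟩
  · rw [if_pos ⟨t, ht⟩, ht, ← two_mul, pow_mul, Nat.pow_mod]; norm_num
  · rw [if_neg (Nat.not_even_iff_odd.mpr ⟨t, ht⟩), ht, pow_succ, pow_mul, Nat.mul_mod,
      Nat.pow_mod]; norm_num

/-- **`(−1)^{s_N} = χ₈(N)`.** If `η · 5^{s} = N` in `ℤ/2^{n+2}` (`n ≥ 1`) with `η ∈ μ₂(ℤ₂) = {±1}`
(the decomposition `N = η_N · γ^{s_N}`, `γ = cyclotomicGenerator 2 = 5`), then `5^s ≡ ±N (mod 8)`,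
so `s` is even iff `N ≡ ±1 (mod 8)`: `(−1)^s = χ₈(N) = (2/N)`. -/
theorem neg_one_pow_val_eq_chi8 {N n : ℕ} (hn : 1 ≤ n)
    {ηN : rootsOfUnity (torsionOrder 2) ℤ_[2]} {sN : ZMod (2 ^ n)}
    (hN : PadicInt.toZModPow (n + cyclotomicExponent 2) ((ηN : ℤ_[2]ˣ) : ℤ_[2]) *
        (cyclotomicGenerator 2 : ZMod (2 ^ (n + cyclotomicExponent 2))) ^ sN.val =
          (N : ZMod (2 ^ (n + cyclotomicExponent 2)))) :
    (-1 : ℤ) ^ sN.val = ZMod.χ₈ (N : ZMod 8) := by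
  set M : ℕ := 2 ^ (n + cyclotomicExponent 2) with hM
  haveI : NeZero M := ⟨pow_ne_zero _ two_ne_zero⟩
  have h8 : 8 ∣ M := by
    rw [hM, cyclotomicExponent_two, show (8 : ℕ) = 2 ^ 3 by norm_num]
    exact Nat.pow_dvd_pow 2 (by omega)
  -- `η = ±1`
  set x : ℤ_[2] := ((ηN : ℤ_[2]ˣ) : ℤ_[2]) with hx
  have hη2 : x * x = 1 := by
    have h : x ^ torsionOrder 2 = 1 := (mem_rootsOfUnity' (torsionOrder 2) (ηN : ℤ_[2]ˣ)).mp ηN.2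
    rwa [torsionOrder_two, pow_two] at h
  rw [cyclotomicGenerator_two] at hN
  set s := sN.val with hs
  -- the congruence `5^s ≡ ± N (mod 8)`
  have hmod : 5 ^ s % 8 = N % 8 ∨ (5 ^ s + N) % 8 = 0 := by
    rcases mul_self_eq_one_iff.mp hη2 with h1 | h1
    · left
      rw [h1, map_one, one_mul] at hN
      have h' : ((5 ^ s : ℕ) : ZMod M) = (N : ZMod M) := by push_cast at hN ⊢; exact hN
      exact Nat.ModEq.of_dvd h8 ((ZMod.natCast_eq_natCast_iff _ _ _).mp h')
    · right
      rw [h1, map_neg, map_one, neg_mul, one_mul] at hN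
      have h' : ((5 ^ s + N : ℕ) : ZMod M) = 0 := by
        push_cast at hN ⊢; rw [← hN]; ring
      have hdvd : M ∣ 5 ^ s + N := (CharP.cast_eq_zero_iff (ZMod M) M _).mp h'
      obtain ⟨c8, hc8⟩ := h8.trans hdvd
      rw [hc8, Nat.mul_mod_right]
  have h5 := five_pow_mod_eight s
  generalize hq : 5 ^ s = q at h5 hmod
  rcases Nat.even_or_odd s with hev | hodd
  · rw [if_pos hev] at h5
    rw [hev.neg_one_pow, ZMod.χ₈_nat_eq_if_mod_eight, if_neg (by omega), if_pos (by omega)]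
  · rw [if_neg (Nat.not_even_iff_odd.mpr hodd)] at h5
    rw [hodd.neg_one_pow, ZMod.χ₈_nat_eq_if_mod_eight, if_neg (by omega), if_neg (by omega)]

/-! ## §3. PARITY OF `λ(θ_n)` AT `p = 2` -/

variable {N : ℕ} [NeZero N] {f : CuspForm (Gamma0 N) 2}

/-- **Exponent form.** `f ∈ S₂(Γ₀(N))` with `f(-1/(Nτ)) = -σ N τ² f(τ)`, `σ = ±1` (EITHER sign),
`n ≥ 2`, `(η_N, s_N)` the class decomposition of `N` mod `2^{n+2}`, `Θ ∈ Λ = ℤ₂⟦T⟧` with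
`ι Θ = θ_n(f)`, `Θ ≠ 0`, `μ(Θ) = 0`, `λ(Θ) + 2 ≤ 2ⁿ`: then `(−s_N mod 2ⁿ) + λ(Θ)` is even. -/
theorem even_val_neg_add_lam_mazurTate_two {σ : ℤ} (hσ : σ = 1 ∨ σ = -1)
    (hW : IsFrickeEigen N f (-(σ : ℂ))) {n : ℕ} (hn : 2 ≤ n)
    {ηN : rootsOfUnity (torsionOrder 2) ℤ_[2]} {sN : ZMod (2 ^ n)}
    (hN : PadicInt.toZModPow (n + cyclotomicExponent 2) ((ηN : ℤ_[2]ˣ) : ℤ_[2]) *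
        (cyclotomicGenerator 2 : ZMod (2 ^ (n + cyclotomicExponent 2))) ^ sN.val =
          (N : ZMod (2 ^ (n + cyclotomicExponent 2))))
    {Θ : IwasawaAlgebra 2}
    (hΘ : iwasawaToPowerSeries 2 Θ =
      ((mazurTateElement f 2 n).map (algebraMap ℚ ℚ_[2]) : PowerSeries ℚ_[2]))
    (hΘ0 : Θ ≠ 0) (hμ : mu Θ = 0) (hlt : lam Θ + 2 ≤ 2 ^ n) :
    Even ((-sN).val + lam Θ) := by
  haveI := charP_residueField_two
  have hσ2 : σ ^ 2 = 1 := by rcases hσ with rfl | rfl <;> norm_num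
  have hFE := cyclotomicOmega_dvd_mazurTateElement_sub hσ2 hW n hN
  set Θbar : (IsLocalRing.ResidueField ℤ_[2])[X] :=
    (PowerSeries.trunc (2 ^ n) Θ).map (IsLocalRing.residue ℤ_[2]) with hΘbar
  have hred : red Θ = (Θbar : PowerSeries (IsLocalRing.ResidueField ℤ_[2])) :=
    red_eq_coe_map_trunc_of_mazurTate hΘ
  have hredne : red Θ ≠ 0 := red_ne_zero_of_mu_eq_zero hΘ0 hμ
  have hΘbar0 : Θbar ≠ 0 := by
    intro h0
    exact hredne (by rw [hred, h0, Polynomial.coe_zero])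
  have hlam : lam Θ = Θbar.natTrailingDegree := by
    obtain ⟨-, h⟩ := mu_eq_zero_and_lam_eq_of_red_ne_zero hredne
    rw [hred, order_coe_eq_natTrailingDegree hΘbar0] at h
    exact_mod_cast h
  have hdvd := X_pow_dvd_reduction_sub_of_mazurTate hFE hΘ
  have hσbar : ((σ : IsLocalRing.ResidueField ℤ_[2])) = 1 := by
    rcases hσ with rfl | rfl
    · push_cast; rfl
    · push_cast; exact CharTwo.neg_eq 1
  rw [hσbar, C_1, one_mul] at hdvd
  have h4 : 4 ∣ 2 ^ n := by
    have h := Nat.pow_dvd_pow 2 hn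
    norm_num at h
    exact h
  have key := even_add_natTrailingDegree_of_dvd_charTwo hΘbar0 h4
    (by rw [← hlam]; exact hlt) hdvd
  rwa [← hlam] at key

/-- **`(−1)^{λ(θ_n)} = χ₈(N) = (2/N)` at `p = 2`.** `f ∈ S₂(Γ₀(N))` with a Fricke sign `σ = ±1`
(either!), `2 ∤ N`, `n ≥ 2`, `Θ ∈ Λ` with `ι Θ = θ_n(f)` (level `2^{n+2}`), `Θ ≠ 0`, `μ(Θ) = 0`,
`λ(Θ) + 2 ≤ 2ⁿ`.  The root number does not enter: the parity of `λ(θ_n)` at `2` is the Kronecker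
symbol `(2/N)`. -/
theorem neg_one_pow_lam_mazurTate_two {σ : ℤ} (hσ : σ = 1 ∨ σ = -1)
    (hW : IsFrickeEigen N f (-(σ : ℂ))) (hN2 : ¬ 2 ∣ N) {n : ℕ} (hn : 2 ≤ n) {Θ : IwasawaAlgebra 2}
    (hΘ : iwasawaToPowerSeries 2 Θ =
      ((mazurTateElement f 2 n).map (algebraMap ℚ ℚ_[2]) : PowerSeries ℚ_[2]))
    (hΘ0 : Θ ≠ 0) (hμ : mu Θ = 0) (hlt : lam Θ + 2 ≤ 2 ^ n) :
    (-1 : ℤ) ^ lam Θ = ZMod.χ₈ (N : ZMod 8) := by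
  haveI : NeZero (2 ^ n) := ⟨pow_ne_zero _ two_ne_zero⟩
  obtain ⟨ηN, sN, hN⟩ := exists_classMap_eq_natCast 2 n hN2
  have hev := even_val_neg_add_lam_mazurTate_two hσ hW hn hN hΘ hΘ0 hμ hlt
  have hχ := neg_one_pow_val_eq_chi8 (by omega : 1 ≤ n) hN
  have hsum : Even ((-sN).val + sN.val) := by
    have h := ZMod.val_add (-sN) sN
    rw [neg_add_cancel, ZMod.val_zero] at h
    have hdvd : 2 ^ n ∣ (-sN).val + sN.val := Nat.dvd_of_mod_eq_zero h.symm
    exact even_iff_two_dvd.mpr ((dvd_pow_self 2 (by omega)).trans hdvd)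
  have e1 : (-1 : ℤ) ^ lam Θ * (-1) ^ (-sN).val = 1 := by
    rw [← pow_add, add_comm]; exact hev.neg_one_pow
  have e2 : (-1 : ℤ) ^ (-sN).val * (-1) ^ sN.val = 1 := by
    rw [← pow_add]; exact hsum.neg_one_pow
  calc (-1 : ℤ) ^ lam Θ = (-1) ^ lam Θ * ((-1) ^ (-sN).val * (-1) ^ sN.val) := by rw [e2, mul_one]
    _ = ((-1) ^ lam Θ * (-1) ^ (-sN).val) * (-1) ^ sN.val := by ring
    _ = (-1) ^ sN.val := by rw [e1, one_mul]
    _ = ZMod.χ₈ (N : ZMod 8) := hχ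

/-- **Corollary: `λ(θ_n)` is even iff `N ≡ ±1 (mod 8)`** (same hypotheses). -/
theorem even_lam_mazurTate_two_iff {σ : ℤ} (hσ : σ = 1 ∨ σ = -1)
    (hW : IsFrickeEigen N f (-(σ : ℂ))) (hN2 : ¬ 2 ∣ N) {n : ℕ} (hn : 2 ≤ n) {Θ : IwasawaAlgebra 2}
    (hΘ : iwasawaToPowerSeries 2 Θ =
      ((mazurTateElement f 2 n).map (algebraMap ℚ ℚ_[2]) : PowerSeries ℚ_[2]))
    (hΘ0 : Θ ≠ 0) (hμ : mu Θ = 0) (hlt : lam Θ + 2 ≤ 2 ^ n) :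
    Even (lam Θ) ↔ N % 8 = 1 ∨ N % 8 = 7 := by
  have key := neg_one_pow_lam_mazurTate_two hσ hW hN2 hn hΘ hΘ0 hμ hlt
  rw [ZMod.χ₈_nat_eq_if_mod_eight, if_neg (by omega)] at key
  constructor
  · intro hev
    by_contra hne
    rw [hev.neg_one_pow, if_neg hne] at key
    norm_num at key
  · intro h8
    rw [if_pos h8] at key
    exact (neg_one_pow_eq_one_iff_even (by norm_num)).mp key

end Summit.BirchSwinnertonDyer.Rank1Residual.Supersingular

end
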